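import Mathlib
import Summits.NavierStokesRegularity.NavierStokesRegularity.Theses.CoreLogGas

/-!
# Route CoreLogGas — support `LogGasNoVacuum` (item stmt-NavierStokesRegularity-2089)

The LOG-GAS COMPARISON INEQUALITY for the forced Lundgren–Ashurst vortex-core system
(Lundgren–Ashurst 1989; Benjamin 1962; Marshall 1991): for the core area `A > 0` and axial
velocity `w`, both `C¹` on `ℝ²` and `L`-periodic in the arclength `s`, with residuals
`σ̃ A := -(A_t + A_s w + A w_s)` and `f̃ := w_t + w w_s + κ A_s / A²` bounded by `S A` and
`F` on `[0, T) × ℝ`, the "sound speed" `c = √(κ / A)` obeys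

  `4 c(t, s) ≤ (sup_y (w + 2c)(0, y) - inf_y (w - 2c)(0, y) + 2 F t) · exp (S t / 2)`

for all `t ∈ [0, T)` and all `s`: no vacuum (`A ↛ 0`) under bounded residuals.

## Proof

One-dimensional real analysis, as in the item text, with one simplification: instead of Danskin's
envelope theorem for `M(τ) = sup_s (w + 2c)(τ, s) - inf_s (w - 2c)(τ, s)` we bound the LEFT upper
Dini derivative of `N(τ) = e^{-Sτ/2} M(τ) - 2Fτ` through the differentiable minorant obtained by
freezing the extremisers `s⁺, s⁻` of time `τ`,
`φ(θ) = e^{-Sθ/2} ((w + 2c)(θ, s⁺) - (w - 2c)(θ, s⁻)) - 2Fθ ≤ N(θ)`, `φ(τ) = N(τ)`;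
here `φ'(τ) ≤ 2F (e^{-Sτ/2} - 1) ≤ 0` by the Riemann-invariant identities
`(w ± 2c)_t + (w ∓ c)(w ± 2c)_s = f̃ ± σ̃ c` at critical points of `s ↦ (w ± 2c)(τ, s)`
(Fermat) and `4c ≤ M`. The Dini comparison lemma `image_le_of_liminf_slope_right_le_deriv_boundary`
applied to `x ↦ -N(t - x)` on `[0, t]` gives `N(t) ≤ N(0) = M(0)`, i.e.
`4c(t, s) ≤ M(t) ≤ (M(0) + 2Ft) e^{St/2}`. Continuity of `M` on `[0, t]`:
`IsCompact.continuous_sSup` over one period after clamping time into `[0, t]` (where `A > 0`).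
Only differentiability (not continuity of the derivatives) of `A, w` is used.

## References

* T. S. Lundgren, W. T. Ashurst, *Area-varying waves on curved vortex tubes with application to
  vortex breakdown*, J. Fluid Mech. 200 (1989) 283–307; T. B. Benjamin, J. Fluid Mech. 14 (1962)
  593–629; J. S. Marshall, J. Fluid Mech. 229 (1991) 311–338.
-/

-- the summit and its single sub-problem share the name (D-0017), as in every Theorems file here
set_option linter.dupNamespace false

open Set Filter Topology

namespace Summit.NavierStokesRegularity.NavierStokesRegularity.Theorems

namespace CoreLogGasLogGasNoVacuum

/-- Partial derivative in the first variable of a differentiable function of two real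
variables. -/
theorem hasDerivAt_fst {f : ℝ → ℝ → ℝ} (hf : Differentiable ℝ (Function.uncurry f))
    (θ y : ℝ) :
    HasDerivAt (fun τ => f τ y) (deriv (fun τ => f τ y) θ) θ := by
  have h : DifferentiableAt ℝ (Function.uncurry f ∘ fun τ : ℝ => (τ, y)) θ :=
    (hf (θ, y)).comp θ (differentiableAt_id.prodMk (differentiableAt_const y))
  exact h.hasDerivAt

/-- Partial derivative in the second variable of a differentiable function of two real
variables. -/
theorem hasDerivAt_snd {f : ℝ → ℝ → ℝ} (hf : Differentiable ℝ (Function.uncurry f))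
    (θ y : ℝ) :
    HasDerivAt (fun z => f θ z) (deriv (fun z => f θ z) y) y := by
  have h : DifferentiableAt ℝ (Function.uncurry f ∘ fun z : ℝ => (θ, z)) y :=
    (hf (θ, y)).comp y ((differentiableAt_const θ).prodMk differentiableAt_id)
  exact h.hasDerivAt

/-- Derivative of `y ↦ √(κ / a y)` at a point where `a > 0`, written as `-(c / a) · a′ / 2`
with `c = √(κ / a)`. -/
theorem hasDerivAt_sqrt_const_div {a : ℝ → ℝ} {a' x κ : ℝ} (hκ : 0 < κ)
    (ha : HasDerivAt a a' x) (hx : 0 < a x) :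
    HasDerivAt (fun y => Real.sqrt (κ / a y))
      (-(Real.sqrt (κ / a x) / a x * a') / 2) x := by
  have h1 : HasDerivAt (fun y => κ / a y) ((0 * a x - κ * a') / a x ^ 2) x :=
    (hasDerivAt_const x κ).div ha hx.ne'
  refine (h1.sqrt (div_pos hκ hx).ne').congr_deriv ?_
  have hc : 0 < Real.sqrt (κ / a x) := Real.sqrt_pos.mpr (div_pos hκ hx)
  have hsq : Real.sqrt (κ / a x) ^ 2 = κ / a x := Real.sq_sqrt (div_pos hκ hx).le
  have hax : a x ≠ 0 := hx.ne'
  field_simp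
  field_simp at hsq
  linear_combination a' * hsq

/-- Derivative of the Riemann invariant `v + 2 √(κ / a)` along a line: `v′ - (c / a) a′`. -/
theorem hasDerivAt_riemannPlus {a v : ℝ → ℝ} {a' v' x κ : ℝ} (hκ : 0 < κ)
    (ha : HasDerivAt a a' x) (hv : HasDerivAt v v' x) (hx : 0 < a x) :
    HasDerivAt (fun y => v y + 2 * Real.sqrt (κ / a y))
      (v' - Real.sqrt (κ / a x) / a x * a') x := by
  refine (hv.add ((hasDerivAt_sqrt_const_div hκ ha hx).const_mul 2)).congr_deriv ?_
  ring

/-- Derivative of the Riemann invariant `v - 2 √(κ / a)` along a line: `v′ + (c / a) a′`. -/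
theorem hasDerivAt_riemannMinus {a v : ℝ → ℝ} {a' v' x κ : ℝ} (hκ : 0 < κ)
    (ha : HasDerivAt a a' x) (hv : HasDerivAt v v' x) (hx : 0 < a x) :
    HasDerivAt (fun y => v y - 2 * Real.sqrt (κ / a y))
      (v' + Real.sqrt (κ / a x) / a x * a') x := by
  refine (hv.sub ((hasDerivAt_sqrt_const_div hκ ha hx).const_mul 2)).congr_deriv ?_
  ring

/-- The `+` Riemann-invariant identity at a critical point: if `c² = κ / A`, the mass residual
`|A_t + A_s w + A w_s| ≤ S A`, the momentum residual `|w_t + w w_s + κ A_s / A²| ≤ F`, and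
`(w + 2c)_s = w_s - (c/A) A_s = 0`, then `(w + 2c)_t = w_t - (c/A) A_t ≤ F + S c`. -/
theorem plus_ineq {κ A c At As wt ws w S F : ℝ} (hA : 0 < A) (hc : 0 < c)
    (hcsq : c ^ 2 = κ / A)
    (h1 : |At + As * w + A * ws| ≤ S * A) (h2 : |wt + w * ws + κ * As / A ^ 2| ≤ F)
    (hcrit : ws - c / A * As = 0) : wt - c / A * At ≤ F + S * c := by
  have hA' : A ≠ 0 := hA.ne'
  have hκ : κ = c ^ 2 * A := by field_simp at hcsq; linarith
  have hws : ws = c / A * As := by linarith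
  have key : wt - c / A * At
      = (wt + w * ws + κ * As / A ^ 2) - c / A * (At + As * w + A * ws) := by
    rw [hκ, hws]; field_simp; ring
  have h3 : c / A * (-(S * A)) ≤ c / A * (At + As * w + A * ws) :=
    mul_le_mul_of_nonneg_left (abs_le.mp h1).1 (div_pos hc hA).le
  have h4 : c / A * (-(S * A)) = -(S * c) := by field_simp
  linarith [(abs_le.mp h2).2]

/-- The `-` Riemann-invariant identity at a critical point: under the same residual bounds and
`(w - 2c)_s = w_s + (c/A) A_s = 0`, one has `(w - 2c)_t = w_t + (c/A) A_t ≥ -(F + S c)`. -/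
theorem minus_ineq {κ A c At As wt ws w S F : ℝ} (hA : 0 < A) (hc : 0 < c)
    (hcsq : c ^ 2 = κ / A)
    (h1 : |At + As * w + A * ws| ≤ S * A) (h2 : |wt + w * ws + κ * As / A ^ 2| ≤ F)
    (hcrit : ws + c / A * As = 0) : -(F + S * c) ≤ wt + c / A * At := by
  have hA' : A ≠ 0 := hA.ne'
  have hκ : κ = c ^ 2 * A := by field_simp at hcsq; linarith
  have hws : ws = -(c / A * As) := by linarith
  have key : wt + c / A * At
      = (wt + w * ws + κ * As / A ^ 2) + c / A * (At + As * w + A * ws) := by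
    rw [hκ, hws]; field_simp; ring
  have h3 : c / A * (-(S * A)) ≤ c / A * (At + As * w + A * ws) :=
    mul_le_mul_of_nonneg_left (abs_le.mp h1).1 (div_pos hc hA).le
  have h4 : c / A * (-(S * A)) = -(S * c) := by field_simp
  linarith [(abs_le.mp h2).1]

/-- A continuous periodic function on `ℝ` (positive period) attains its supremum. -/
theorem exists_forall_le_of_periodic {f : ℝ → ℝ} {L : ℝ} (hf : Continuous f)
    (hp : Function.Periodic f L) (hL : 0 < L) : ∃ x, ∀ y, f y ≤ f x := by
  obtain ⟨x, -, hx⟩ := (isCompact_Icc : IsCompact (Icc (0:ℝ) L)).exists_isMaxOn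
    (nonempty_Icc.mpr hL.le) hf.continuousOn
  refine ⟨x, fun y => ?_⟩
  obtain ⟨z, hz, hyz⟩ := hp.exists_mem_Ico₀ hL y
  rw [hyz]
  exact hx (Ico_subset_Icc_self hz)

/-- A continuous periodic function on `ℝ` (positive period) attains its infimum. -/
theorem exists_forall_ge_of_periodic {f : ℝ → ℝ} {L : ℝ} (hf : Continuous f)
    (hp : Function.Periodic f L) (hL : 0 < L) : ∃ x, ∀ y, f x ≤ f y := by
  obtain ⟨x, hx⟩ := exists_forall_le_of_periodic (f := fun y => -f y) hf.neg
    (fun y => by show -f (y + L) = -f y; rw [hp y]) hL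
  exact ⟨x, fun y => neg_le_neg_iff.mp (hx y)⟩

/-- Clamping the parameter `θ` into `[0, t]` (`0 ≤ t`) turns a family `P` that is jointly
continuous at every point with `θ ∈ [0, t]` into a globally continuous function of `(θ, y)`. -/
theorem continuous_clamp {P : ℝ → ℝ → ℝ} {t : ℝ} (ht : 0 ≤ t)
    (hcont : ∀ p : ℝ × ℝ, p.1 ∈ Icc 0 t → ContinuousAt (Function.uncurry P) p) :
    Continuous (fun p : ℝ × ℝ => P (max 0 (min p.1 t)) p.2) := by
  have hcl : Continuous (fun θ : ℝ => max 0 (min θ t)) :=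
    continuous_const.max (continuous_id.min continuous_const)
  rw [continuous_iff_continuousAt]
  rintro ⟨θ, y⟩
  have h1 : ContinuousAt (fun p : ℝ × ℝ => (max 0 (min p.1 t), p.2)) (θ, y) :=
    (hcl.prodMap continuous_id).continuousAt
  exact (hcont _ ⟨le_max_left _ _, max_le ht (min_le_right _ _)⟩).comp_of_eq h1 rfl

/-- Parametric supremum of a periodic family: if `(θ, y) ↦ P θ y` is continuous at every point
with `θ ∈ [0, t]` and each `P θ` is `L`-periodic (`L > 0`), then `θ ↦ ⨆ y, P θ y` is
continuous on `[0, t]` (`IsCompact.continuous_sSup` over one period, after clamping `θ`). -/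
theorem continuousOn_iSup_of_periodic {P : ℝ → ℝ → ℝ} {L t : ℝ} (hL : 0 < L)
    (hcont : ∀ p : ℝ × ℝ, p.1 ∈ Icc 0 t → ContinuousAt (Function.uncurry P) p)
    (hper : ∀ θ, Function.Periodic (P θ) L) :
    ContinuousOn (fun θ => ⨆ y, P θ y) (Icc 0 t) := by
  rcases lt_or_ge t 0 with ht | ht
  · rw [Icc_eq_empty (not_le.mpr ht)]
    exact continuousOn_empty _
  have hc := (isCompact_Icc : IsCompact (Icc (0:ℝ) L)).continuous_sSup
    (f := fun θ y => P (max 0 (min θ t)) y) (continuous_clamp ht hcont)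
  refine hc.continuousOn.congr (fun θ hθ => ?_)
  have hcl : max 0 (min θ t) = θ := by simp [hθ.1, hθ.2]
  have himg := (hper θ).image_Icc hL 0
  rw [zero_add] at himg
  simp only [hcl]
  change (⨆ y, P θ y) = sSup ((P θ) '' Icc 0 L)
  rw [himg, sSup_range]

/-- Parametric infimum of a periodic family: if `(θ, y) ↦ P θ y` is continuous at every point
with `θ ∈ [0, t]` and each `P θ` is `L`-periodic (`L > 0`), then `θ ↦ ⨅ y, P θ y` is
continuous on `[0, t]`. -/
theorem continuousOn_iInf_of_periodic {P : ℝ → ℝ → ℝ} {L t : ℝ} (hL : 0 < L)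
    (hcont : ∀ p : ℝ × ℝ, p.1 ∈ Icc 0 t → ContinuousAt (Function.uncurry P) p)
    (hper : ∀ θ, Function.Periodic (P θ) L) :
    ContinuousOn (fun θ => ⨅ y, P θ y) (Icc 0 t) := by
  rcases lt_or_ge t 0 with ht | ht
  · rw [Icc_eq_empty (not_le.mpr ht)]
    exact continuousOn_empty _
  have hc := (isCompact_Icc : IsCompact (Icc (0:ℝ) L)).continuous_sInf
    (f := fun θ y => P (max 0 (min θ t)) y) (continuous_clamp ht hcont)
  refine hc.continuousOn.congr (fun θ hθ => ?_)
  have hcl : max 0 (min θ t) = θ := by simp [hθ.1, hθ.2]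
  have himg := (hper θ).image_Icc hL 0
  rw [zero_add] at himg
  simp only [hcl]
  change (⨅ y, P θ y) = sInf ((P θ) '' Icc 0 L)
  rw [himg, sInf_range]

end CoreLogGasLogGasNoVacuum

open CoreLogGasLogGasNoVacuum

open Summit.NavierStokesRegularity.NavierStokesRegularity.Theses.CoreLogGas in
/-- **`LogGasNoVacuum` holds** (route CoreLogGas, support item stmt-NavierStokesRegularity-2089):
the log-gas comparison inequality `4 √(κ / A t s) ≤ (sup_y (w 0 y + 2√(κ/A 0 y)) -
inf_y (w 0 y - 2√(κ/A 0 y)) + 2 F t) · exp (S t / 2)` for every `C¹`, `L`-periodic pair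
`(A, w)` with `A > 0` on `[0, T) × ℝ` whose Lundgren–Ashurst residuals are bounded by `S · A`
and `F`.
See the module docstring for the proof (Riemann invariants + Fermat at the extremisers + a
left-Dini-derivative Grönwall argument through a differentiable minorant). -/
theorem coreLogGas_logGasNoVacuum_proof : LogGasNoVacuum := by
  intro κ L T F S hκ hL hT hF hS A w hA hw hAper hwper hpos hres t ht s
  -- Riemann invariants `P = w + 2c`, `Q = w - 2c`, `c = √(κ/A)`
  set P : ℝ → ℝ → ℝ := fun θ y => w θ y + 2 * Real.sqrt (κ / A θ y) with hP_def
  set Q : ℝ → ℝ → ℝ := fun θ y => w θ y - 2 * Real.sqrt (κ / A θ y) with hQ_def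
  -- partial derivatives of `A` and `w`
  have hAt := hasDerivAt_fst (hA.differentiable one_ne_zero)
  have hwt := hasDerivAt_fst (hw.differentiable one_ne_zero)
  have hAs := hasDerivAt_snd (hA.differentiable one_ne_zero)
  have hws := hasDerivAt_snd (hw.differentiable one_ne_zero)
  -- joint continuity of `P`, `Q` on the positivity region, continuity and periodicity of slices
  have hPcontAt : ∀ p : ℝ × ℝ, p.1 ∈ Ico 0 T → ContinuousAt (Function.uncurry P) p := by
    rintro ⟨θ, y⟩ hθ
    have hAc : ContinuousAt (Function.uncurry A) (θ, y) := hA.continuous.continuousAt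
    have : ContinuousAt (fun p : ℝ × ℝ => Function.uncurry w p
        + 2 * Real.sqrt (κ / Function.uncurry A p)) (θ, y) :=
      hw.continuous.continuousAt.add
        (continuousAt_const.mul ((continuousAt_const.div hAc (hpos θ hθ y).ne').sqrt))
    exact this
  have hQcontAt : ∀ p : ℝ × ℝ, p.1 ∈ Ico 0 T → ContinuousAt (Function.uncurry Q) p := by
    rintro ⟨θ, y⟩ hθ
    have hAc : ContinuousAt (Function.uncurry A) (θ, y) := hA.continuous.continuousAt
    have : ContinuousAt (fun p : ℝ × ℝ => Function.uncurry w p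
        - 2 * Real.sqrt (κ / Function.uncurry A p)) (θ, y) :=
      hw.continuous.continuousAt.sub
        (continuousAt_const.mul ((continuousAt_const.div hAc (hpos θ hθ y).ne').sqrt))
    exact this
  have hPcont : ∀ θ ∈ Ico 0 T, Continuous (P θ) := fun θ hθ =>
    continuous_iff_continuousAt.mpr fun y =>
      (hPcontAt (θ, y) hθ).comp_of_eq (Continuous.prodMk_right θ).continuousAt rfl
  have hQcont : ∀ θ ∈ Ico 0 T, Continuous (Q θ) := fun θ hθ =>
    continuous_iff_continuousAt.mpr fun y =>
      (hQcontAt (θ, y) hθ).comp_of_eq (Continuous.prodMk_right θ).continuousAt rfl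
  have hPper : ∀ θ, Function.Periodic (P θ) L := fun θ y => by
    simp only [hP_def]; rw [hAper θ y, hwper θ y]
  have hQper : ∀ θ, Function.Periodic (Q θ) L := fun θ y => by
    simp only [hQ_def]; rw [hAper θ y, hwper θ y]
  -- extremisers of the slices
  have hPmax : ∀ θ ∈ Ico 0 T, ∃ x, ∀ y, P θ y ≤ P θ x := fun θ hθ =>
    exists_forall_le_of_periodic (hPcont θ hθ) (hPper θ) hL
  have hQmin : ∀ θ ∈ Ico 0 T, ∃ x, ∀ y, Q θ x ≤ Q θ y := fun θ hθ =>
    exists_forall_ge_of_periodic (hQcont θ hθ) (hQper θ) hL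
  have hPbdd : ∀ θ ∈ Ico 0 T, BddAbove (range (P θ)) := fun θ hθ => by
    obtain ⟨x, hx⟩ := hPmax θ hθ
    exact ⟨P θ x, by rintro _ ⟨y, rfl⟩; exact hx y⟩
  have hQbdd : ∀ θ ∈ Ico 0 T, BddBelow (range (Q θ)) := fun θ hθ => by
    obtain ⟨x, hx⟩ := hQmin θ hθ
    exact ⟨Q θ x, by rintro _ ⟨y, rfl⟩; exact hx y⟩
  -- the spread `M = sup P - inf Q ≥ 4c`, continuous on `[0, t]`
  set M : ℝ → ℝ := fun θ => (⨆ y, P θ y) - (⨅ y, Q θ y) with hM_def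
  have hPQM : ∀ θ ∈ Ico 0 T, ∀ x y, P θ x - Q θ y ≤ M θ := by
    intro θ hθ x y
    have h1 : P θ x ≤ ⨆ y, P θ y := le_ciSup (hPbdd θ hθ) x
    have h2 : (⨅ y, Q θ y) ≤ Q θ y := ciInf_le (hQbdd θ hθ) y
    simp only [hM_def]
    linarith
  have h4c : ∀ θ ∈ Ico 0 T, ∀ y, 4 * Real.sqrt (κ / A θ y) ≤ M θ := by
    intro θ hθ y
    have : 4 * Real.sqrt (κ / A θ y) = P θ y - Q θ y := by simp only [hP_def, hQ_def]; ring
    rw [this]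
    exact hPQM θ hθ y y
  have hMcont : ContinuousOn M (Icc 0 t) :=
    (continuousOn_iSup_of_periodic (t := t) hL
      (fun p hp => hPcontAt p ⟨hp.1, hp.2.trans_lt ht.2⟩) hPper).sub
    (continuousOn_iInf_of_periodic (t := t) hL
      (fun p hp => hQcontAt p ⟨hp.1, hp.2.trans_lt ht.2⟩) hQper)
  -- Grönwall for the LEFT Dini derivative of `N θ = exp(-Sθ/2) M θ - 2Fθ`, via `x ↦ -N (t-x)`
  set N : ℝ → ℝ := fun θ => Real.exp (-(S * θ / 2)) * M θ - 2 * F * θ with hN_def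
  have hNcont : ContinuousOn N (Icc 0 t) := by
    have he : Continuous fun θ : ℝ => Real.exp (-(S * θ / 2)) := by fun_prop
    exact (he.continuousOn.mul hMcont).sub (continuousOn_const.mul continuousOn_id)
  have hfcont : ContinuousOn (fun x => -N (t - x)) (Icc 0 t) := by
    have h1 : ContinuousOn (fun x : ℝ => t - x) (Icc 0 t) :=
      (continuous_const.sub continuous_id).continuousOn
    have h2 : MapsTo (fun x : ℝ => t - x) (Icc 0 t) (Icc 0 t) := fun x hx =>
      ⟨by linarith [hx.2], by linarith [hx.1]⟩
    exact (hNcont.comp h1 h2).neg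
  have hbound : ∀ x ∈ Ico 0 t, ∀ r, (0:ℝ) < r →
      ∃ᶠ z in 𝓝[>] x, slope (fun x => -N (t - x)) x z < r := by
    intro x hx r hr
    have hτ : t - x ∈ Ico 0 T := ⟨by linarith [hx.2], by linarith [hx.1, ht.2]⟩
    obtain ⟨sp, hsp⟩ := hPmax (t - x) hτ
    obtain ⟨sm, hsm⟩ := hQmin (t - x) hτ
    -- the differentiable minorant `φ ≤ N` with `φ (t - x) = N (t - x)`
    set φ : ℝ → ℝ := fun θ => Real.exp (-(S * θ / 2)) * (P θ sp - Q θ sm) - 2 * F * θ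
      with hφ_def
    have hφN : ∀ θ ∈ Ico 0 T, φ θ ≤ N θ := by
      intro θ hθ
      have h1 := hPQM θ hθ sp sm
      have h2 : 0 < Real.exp (-(S * θ / 2)) := Real.exp_pos _
      simp only [hφ_def, hN_def]
      nlinarith
    have hφτ : φ (t - x) = N (t - x) := by
      have h1 : (⨆ y, P (t - x) y) = P (t - x) sp := by
        have : IsGreatest (range (P (t - x))) (P (t - x) sp) :=
          ⟨⟨sp, rfl⟩, by rintro _ ⟨y, rfl⟩; exact hsp y⟩
        rw [← sSup_range]; exact this.csSup_eq
      have h2 : (⨅ y, Q (t - x) y) = Q (t - x) sm := by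
        have : IsLeast (range (Q (t - x))) (Q (t - x) sm) :=
          ⟨⟨sm, rfl⟩, by rintro _ ⟨y, rfl⟩; exact hsm y⟩
        rw [← sInf_range]; exact this.csInf_eq
      simp only [hφ_def, hN_def, hM_def, h1, h2]
    have hposp := hpos (t - x) hτ sp; have hposm := hpos (t - x) hτ sm
    have hcp : 0 < Real.sqrt (κ / A (t - x) sp) := Real.sqrt_pos.mpr (div_pos hκ hposp)
    have hcm : 0 < Real.sqrt (κ / A (t - x) sm) := Real.sqrt_pos.mpr (div_pos hκ hposm)
    have hdP := hasDerivAt_riemannPlus hκ (hAt (t - x) sp) (hwt (t - x) sp) hposp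
    have hdQ := hasDerivAt_riemannMinus hκ (hAt (t - x) sm) (hwt (t - x) sm) hposm
    have hcritP := IsLocalMax.hasDerivAt_eq_zero (Filter.Eventually.of_forall hsp)
      (hasDerivAt_riemannPlus hκ (hAs (t - x) sp) (hws (t - x) sp) hposp)
    have hcritQ := IsLocalMin.hasDerivAt_eq_zero (Filter.Eventually.of_forall hsm)
      (hasDerivAt_riemannMinus hκ (hAs (t - x) sm) (hws (t - x) sm) hposm)
    have hineqP := plus_ineq hposp hcp (Real.sq_sqrt (div_pos hκ hposp).le)
      (hres (t - x) hτ sp).1 (hres (t - x) hτ sp).2 hcritP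
    have hineqQ := minus_ineq hposm hcm (Real.sq_sqrt (div_pos hκ hposm).le)
      (hres (t - x) hτ sm).1 (hres (t - x) hτ sm).2 hcritQ
    have hcc : Real.sqrt (κ / A (t - x) sp) + Real.sqrt (κ / A (t - x) sm)
        ≤ (P (t - x) sp - Q (t - x) sm) / 2 := by
      have h1 := hsp sm
      have h2 := hsm sp
      simp only [hP_def, hQ_def] at h1 h2 ⊢
      linarith
    set E : ℝ := Real.exp (-(S * (t - x) / 2)) with hE_def
    set D : ℝ := P (t - x) sp - Q (t - x) sm with hD_def
    set dP : ℝ := deriv (fun τ => w τ sp) (t - x)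
      - Real.sqrt (κ / A (t - x) sp) / A (t - x) sp * deriv (fun τ => A τ sp) (t - x)
      with hdP_def
    set dQ : ℝ := deriv (fun τ => w τ sm) (t - x)
      + Real.sqrt (κ / A (t - x) sm) / A (t - x) sm * deriv (fun τ => A τ sm) (t - x)
      with hdQ_def
    have hexp : HasDerivAt (fun θ => Real.exp (-(S * θ / 2))) (E * (-(S * 1 / 2))) (t - x) :=
      (((hasDerivAt_id' (t - x)).const_mul S).div_const 2).neg.exp
    have hφd : HasDerivAt φ (E * (-(S / 2)) * D + E * (dP - dQ) - 2 * F) (t - x) := by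
      have := (hexp.mul (hdP.sub hdQ)).sub ((hasDerivAt_id' (t - x)).const_mul (2 * F))
      refine this.congr_deriv ?_
      simp only [Pi.sub_apply, hD_def, hP_def, hQ_def]
      ring
    have hφ'le : E * (-(S / 2)) * D + E * (dP - dQ) - 2 * F ≤ 0 := by
      have hE1 : E ≤ 1 := by
        apply Real.exp_le_one_iff.mpr
        have : 0 ≤ S * (t - x) := mul_nonneg hS hτ.1
        linarith
      have hsum : -(S / 2) * D + (dP - dQ) ≤ 2 * F := by
        have := mul_le_mul_of_nonneg_left hcc hS
        linarith
      have h1 := mul_le_mul_of_nonneg_left hsum (Real.exp_pos (-(S * (t - x) / 2))).le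
      have h2 := mul_le_mul_of_nonneg_left hE1 hF
      nlinarith
    -- the reflected minorant `z ↦ -φ (t - z)` has derivative `φ' ≤ 0 < r` at `x`
    have hg :
        HasDerivAt (fun z => -φ (t - z)) (E * (-(S / 2)) * D + E * (dP - dQ) - 2 * F) x := by
      refine (hφd.comp x ((hasDerivAt_id' x).const_sub t)).neg.congr_deriv ?_
      ring
    have hev1 := (hg.tendsto_slope.mono_left (nhdsGT_le_nhdsNE x)).eventually_lt_const
      (lt_of_le_of_lt hφ'le hr)
    have hev2 : ∀ᶠ z in 𝓝[>] x, slope (fun x => -N (t - x)) x z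
        ≤ slope (fun z => -φ (t - z)) x z := by
      filter_upwards [Ioo_mem_nhdsGT hx.2] with z hz
      rw [slope_def_field, slope_def_field]
      apply div_le_div_of_nonneg_right _ (by linarith [hz.1])
      have hz' : t - z ∈ Ico 0 T := ⟨by linarith [hz.2], by linarith [hz.1, hx.1, ht.2]⟩
      have := hφN (t - z) hz'
      linarith [hφτ]
    exact (hev2.and hev1).mono (fun z hz => hz.1.trans_lt hz.2) |>.frequently
  have key := image_le_of_liminf_slope_right_le_deriv_boundary (f := fun x => -N (t - x))
    (a := 0) (b := t) (B := fun _ => -N t) (B' := fun _ => 0) hfcont (by simp)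
    continuousOn_const (fun x _ => hasDerivWithinAt_const _ _ _) hbound
    (x := t) ⟨ht.1, le_rfl⟩
  have hNle : N t ≤ N 0 := by simpa using key
  -- conclusion: `4c ≤ M t ≤ (M 0 + 2Ft) exp(St/2)`
  have hMt : M t ≤ (M 0 + 2 * F * t) * Real.exp (S * t / 2) := by
    have hN0 : N 0 = M 0 := by simp [hN_def]
    rw [hN0] at hNle
    simp only [hN_def] at hNle
    have h1 : Real.exp (-(S * t / 2)) * Real.exp (S * t / 2) = 1 := by
      rw [← Real.exp_add]; simp
    have h3 : M t = (Real.exp (-(S * t / 2)) * M t) * Real.exp (S * t / 2) := by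
      rw [mul_comm (Real.exp _) (M t), mul_assoc, h1, mul_one]
    rw [h3]
    exact mul_le_mul_of_nonneg_right (by linarith) (Real.exp_pos _).le
  change 4 * Real.sqrt (κ / A t s) ≤ (M 0 + 2 * F * t) * Real.exp (S * t / 2)
  exact (h4c t ht s).trans hMt

end Summit.NavierStokesRegularity.NavierStokesRegularity.Theorems
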